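/-
Copyright (c) 2026 the pub-hodgecm-mathlib formalisation cell (harness21).  Prover seat hodgecm-mathlib-LH10-p01 (g10): road M6 «ROW 2 ★ DYADIC TWIN» (LEAD F0P3a-plan T14-66),
dealer LH4-plan (g8) WORD #60 «F4-ROW-ODD ∕ R2» = the dyadic-safe (W-ODD ∕ uniformiser-frame) twin of ★ `DepthZeroKappaTransferTypeTwoRowTwo` (A-p19 (g26), the HEAD (D4) of
T3′ P-2 row (R2²)) over ★ R1 `…RowTwoPlaceWildOddFree` (this seat); 2026-09-02.
-/
import Literature.NumberTheory.Rogawski1990.DepthZeroKappaTransferTypeTwoRowTwoPlaceWildOddFree  -- ★ R1 (this seat): `ncard_selfDual_cyclic_typeTwo_eq_ite_wildOdd` (the one-place row value, any residue characteristic)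
import Literature.NumberTheory.Rogawski1990.TypeTwoOnePlaceData                    -- ★ (D1) A-p12 (g22) ∕ F0P2-p01 (g14): `exists_typeTwo_onePlace_data`
import Literature.NumberTheory.Rogawski1990.DepthZeroKappaTransferTypeTwoUnitRow     -- ★ p846128 O8d-2u: the binder currency of the type-(2) rows (brings ★ transport `ncard_fixedBy_rankStratum_eq_ncard_localNonsplitEquiv`)
import Literature.NumberTheory.Automorphic.DeepElementCyclicLatticeStable           -- ★ rider `ncard_fixedBy_unitary_rank_eq_ncard_free'`
import HarnessLib

/-!
# The depth-zero κ-transfer, type (2): ROW 2 at ANY residue characteristic (W-ODD ∕ uniformiser frame) — the free stratum of the two type-(2) classes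

Topic `NumberTheory/Rogawski1990`; namespace `Literature.NumberTheory.Rogawski1990`.  THEOREMS ONLY (no definition, no instance, no notation, no named fact, no `sorry`); kernel lane
`--supports stmt-HodgeConjecture-24833`.  Cell `pub/hodgecm-mathlib` (D-0151), crux H413; road M6 «ROW 2 ★ DYADIC TWIN» (LEAD F0P3a-plan (g15) T14-66), dealer LH4-plan (g8)
WORD #60 «R2».  DYADIC-SAFE TWIN of ★ `DepthZeroKappaTransferTypeTwoRowTwo` (A-p19 (g26); binder `h2 : IsUnit (2 : 𝒪_w)`): both theorems re-threaded with `h2` DELETED,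
`{e : ℕ} (he : |2|_v = exp(−e))` a PARAMETER (`e = 0` = tame), side condition `1 ≤ N − e + n`, VALUE exponent `N − e + n − 1`; the one-place value now comes from ★ R1
`ncard_selfDual_cyclic_typeTwo_eq_ite_wildOdd` (`…RowTwoPlaceWildOddFree`, over ★ p852850 ∕ ★ p852817 ∕ ★ p852827 ∕ ★ p852835 ∕ ★ α1 ∕ ★ B-p08), whose extra binder
`hχ1 : |1 − t + D|_w < 1` is DERIVED here from the row's own depth-zero hypothesis (`charpoly δ_w ≡ (X − 1)³`: coefficient `0` gives `|uD − 1| < 1`, hence `|D − 1| < 1` with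
★ (D1)'s `|u − 1| < 1`, `D ∈ 𝒪`; with `|t − 2| < 1`: `|1 − t + D| < 1`).  Steps 1–3 of ★ otherwise VERBATIM (★ (D1) `exists_typeTwo_onePlace_data` is `|2|`-free).  Row shape: ODD
order `|tr² − 4 det|_w = exp(−(2N+1))` (tame places and the W-ODD dyadic row); the W-UNIT dyadic row (even order, Eisenstein frame) is the sibling F4-ROW-UNIT.
  **`n₂(δ₊) − n₂(δ₋) = (−1)^n · (q+1) · q^{N−e+n−1}`** (`ncard_rankStrata_two_sub_eq_neg_one_pow_mul_wildOdd`), from the per-class value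
  **`n₂(δ) = (q+1)·q^{N−e+n−1}` if `κ_v(γ_H, δ) = (−1)^n`, else `0`** (`ncard_rankStratum_two_typeTwo_eq_ite_wildOdd`).
ASSEMBLY (architect A-p16 (g30) A-145∕A-152∕A-158): CM → one place (★ `ncard_fixedBy_rankStratum_eq_ncard_localNonsplitEquiv` ∘ ★ rider `ncard_fixedBy_unitary_rank_eq_ncard_free′`)
· ★ (D1) one-place data (A-p12 (g22)) · FILE 1 `ncard_selfDual_cyclic_typeTwo_eq_ite` (★ (D2-α∕β) F0P2-p06 (g11) · ★ (D2-γ∕γ-CM) B-p14 (g37) over ★ [T2-b] seam + core · ★ (D3)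
bridge · ★ [T2-a] torsor count F0P3b-p01 (g12) · ★ [T2-c] unit index + ★ (D5) discharge F0P3a-p08 (g18)) · the κ-reading `κ = 1 ↔ ord_w d₀ even` of ★ (D1).
HONEST LABEL: HC_CM is proved only modulo the 7 printed citations (2 remaining named inputs: hLiu418 = stmt-HodgeConjecture-24832, h413 = stmt-HodgeConjecture-24833) until rung 0 closes;
unconditional local algebra, count-neutral (zero label movement until F5 ★ + a desk-priced rider).

## References
* [Rogawski1990] J. D. Rogawski, *Automorphic Representations of Unitary Groups in Three Variables* (1990): §4.9 Lemma 4.9.3 p. 56, Prop. 4.9.1 (b) p. 55.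
* [Flicker1998UnitaryFL] Y. Z. Flicker, *Elementary proof of the fundamental lemma for a unitary group*, Canad. J. Math. 50 (1998): Props. 16–17 pp. 95–97.
* [Kottwitz1986] R. E. Kottwitz, *Base change for unit elements of Hecke algebras*, Compositio Math. 60 (1986): §3.
* [LanglandsShelstad1987] R. P. Langlands, D. Shelstad, *On the definition of transfer factors*, Math. Ann. 278 (1987): §1.
-/

set_option autoImplicit false

noncomputable section

open NumberField IsDedekindDomain Matrix Polynomial Finset
open scoped MatrixGroups WithZero ValuativeRel

namespace Literature.NumberTheory.Rogawski1990

open ValuativeRel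
open Literature.NumberTheory.Automorphic Literature.NumberTheory.Automorphic.UnitaryGroup
open Literature.NumberTheory.GaloisRepresentations Literature.NumberTheory.NumberFields

variable (L : Type) [Field L] [NumberField L] [IsCMField L] {v : HeightOneSpectrum (𝓞 ↥(maximalRealSubfield L))}

/-! ## The CM per-class value and the row -/

section CM

open Literature.NumberTheory.Automorphic.IntegralReduction

variable (H' : Matrix (Fin 3) (Fin 3) L)

set_option synthInstance.maxHeartbeats 200000 in
set_option maxHeartbeats 800000 in
open scoped Classical in
/-- **ROW 2, ONE TYPE-(2) CLASS (CM currency), ANY RESIDUE CHARACTERISTIC.**  For a type-(2) `G`-regular `γ_H` at an inert-unramified `v` (`|2|_v = exp(−e)`, dyadic allowed) with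
`H′` hyperspecial at the CM place `w`, eigen-discriminant of ODD order `2N + 1`, and a deep match `δ ∈ G′_v` (`IsLocalNormPair`, `δ_w ≡ 1`), the regular-nilpotent stratum of the
`δ`-fixed cosets counts `(q+1)·q^{N−e+n−1}` if `κ_v(γ_H, δ) = (−1)^n` and `0` otherwise: ★ transport ∘ ★ rider ∘ ★ (D1) ∘ ★ R1 `ncard_selfDual_cyclic_typeTwo_eq_ite_wildOdd` (with
`hχ1` derived from the depth-zero binder) ∘ the κ-reading `κ = 1 ↔ ord_w d₀ even`.  Dyadic-safe twin of ★ `ncard_rankStratum_two_typeTwo_eq_ite`.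
[cite: Rogawski1990, §4.9 Lemma 4.9.3 p. 56, Prop. 4.9.1 (b) p. 55] [cite: Kottwitz1986, §3] [cite: LanglandsShelstad1987, §1] -/
theorem ncard_rankStratum_two_typeTwo_eq_ite_wildOdd
    (hH' : (H'.map (IsCMField.complexConj L))ᵀ = H') (w : PlacesOver L v)
    (hw : IsCMField.complexConj L • w.1 = w.1) (hv : Algebra.IsUnramifiedIn (𝓞 L) v.asIdeal)
    (hH'w : IsUnit (placeForm H' w.1)) (hH'i : hH'w.unit ∈ glInt 3 (w.1.adicCompletion L))
    {e : ℕ} (he : Valued.v (2 : v.adicCompletion ↥(maximalRealSubfield L)) = WithZero.exp (-(e : ℤ)))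
    {γH : (cmDatum L 2 (Matrix.of fun i j : Fin 2 => if i.val + j.val + 1 = 2 then (1 : L) else 0)).Local v ×
      (cmDatum L 1 (Matrix.of fun i j : Fin 1 => if i.val + j.val + 1 = 1 then (1 : L) else 0)).Local v}
    (hreg : IsLocalGRegular L v γH)
    (hirr : ¬ ∃ x : w.1.adicCompletion L, (((γH.1.val : GL (Fin 2) (LocalRing L v)).val.map
      (Pi.evalRingHom (fun w' : PlacesOver L v => w'.1.adicCompletion L) w)).charpoly).IsRoot x)
    (n N : ℕ)
    (hn : Valued.v (((finCharpolyTwo L v γH).eval (finGammaTwo L v γH)) w) = WithZero.exp (-(n : ℤ)))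
    (hN : Valued.v (((γH.1.val : GL (Fin 2) (LocalRing L v)).val.map
        (Pi.evalRingHom (fun w' : PlacesOver L v => w'.1.adicCompletion L) w)).trace ^ 2 -
        4 * ((γH.1.val : GL (Fin 2) (LocalRing L v)).val.map
        (Pi.evalRingHom (fun w' : PlacesOver L v => w'.1.adicCompletion L) w)).det) = WithZero.exp (-((2 * N + 1 : ℕ) : ℤ)))
    (hNn : 1 ≤ N - e + n)
    {δ : (cmDatum L 3 H').Local v} (hδ : IsLocalNormPair L H' v γH δ)
    (ht : ∀ m : ℕ, ValuativeRel.valuation (w.1.adicCompletion L)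
      (((((δ.val : GL (Fin 3) (LocalRing L v)).val.map
        (Pi.evalRingHom (fun w' : UnitaryGroup.PlacesOver L v => w'.1.adicCompletion L) w))).charpoly - (Polynomial.X - 1) ^ 3).coeff m) < 1) :
    (({q : (cmDatum L 3 H').Local v ⧸ cmLocalIntegralLevel L 3 H' v |
        q ∈ MulAction.fixedBy ((cmDatum L 3 H').Local v ⧸ cmLocalIntegralLevel L 3 H' v) δ ∧
          (redMat ((((q.out⁻¹ * δ * q.out : (cmDatum L 3 H').Local v)).val : GL (Fin 3) (LocalRing L v)).val.map
            (Pi.evalRingHom (fun w' : UnitaryGroup.PlacesOver L v => w'.1.adicCompletion L) w)) - 1).rank = 2}.ncard : ℕ) : ℚ) =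
      if (finKappaAt L v H' γH δ = 1 ↔ Even n) then
        (((Ideal.absNorm v.asIdeal + 1) * Ideal.absNorm v.asIdeal ^ (N - e + n - 1) : ℕ) : ℚ) else 0 := by
  classical
  haveI : Algebra.IsQuadraticExtension ↥(maximalRealSubfield L) L := IsCMField.isQuadraticExtension L
  have hc1 : IsCMField.complexConj L ≠ 1 := IsCMField.complexConj_ne_one L
  -- Step 1: the stratum as a count of self-dual `δ_w`-cyclic lattices (★ transport ∘ ★ rider)
  rw [ncard_fixedBy_rankStratum_eq_ncard_localNonsplitEquiv L 3 H' v w hw δ 2]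
  have hrid := ncard_fixedBy_unitary_rank_eq_ncard_free' (galAdicCompletionMap (L := L) (IsCMField.complexConj L) hw) hH'w.unit
    (localNonsplitEquiv (IsCMField.complexConj L) H' hc1 w hw δ) ht
  simp only [show (3 : ℕ) - 1 = 2 from rfl] at hrid
  refine (congrArg (fun m : ℕ => (m : ℚ)) hrid).trans ?_
  have hcoe : (((localNonsplitEquiv (IsCMField.complexConj L) H' hc1 w hw δ :
      ↥(unitaryGroupOfForm (galAdicCompletionMap (L := L) (IsCMField.complexConj L) hw) (placeForm H' w.1))) :
        GL (Fin 3) (w.1.adicCompletion L)) : Matrix (Fin 3) (Fin 3) (w.1.adicCompletion L)) =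
      ((δ.val : GL (Fin 3) (LocalRing L v)) : Matrix (Fin 3) (Fin 3) (LocalRing L v)).map
        (Pi.evalRingHom (fun w' : PlacesOver L v => w'.1.adicCompletion L) w) := rfl
  simp only [hcoe]
  -- Step 2: ★ (D1) the one-place data, and the one-place value
  obtain ⟨u, t, D, w₀, x₀, -, -, -, -, -, hDO, hχ, -, -, -, hτU, hσu, hσD, hσt, hn', hdisc, hu1, ht2, -, -, hK, hx₀0, hx₀, -, -, hκ⟩ :=
    exists_typeTwo_onePlace_data L H' hH' w hw hv hH'w hreg hirr n N hn hN hδ ht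
  -- integrality of `charpoly δ_w` in the `ValuativeRel` currency (★ `charpoly_coeff_mem_integer_of_deep`; ★ (D1) states it in the `Valued` currency)
  have hint : ∀ i : ℕ, ((((δ.val : GL (Fin 3) (LocalRing L v)) : Matrix (Fin 3) (Fin 3) (LocalRing L v)).map
      (Pi.evalRingHom (fun w' : PlacesOver L v => w'.1.adicCompletion L) w))).charpoly.coeff i ∈ 𝒪[w.1.adicCompletion L] := fun i => by
    rw [← hcoe]
    exact charpoly_coeff_mem_integer_of_deep
      ((localNonsplitEquiv (IsCMField.complexConj L) H' hc1 w hw δ :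
        ↥(unitaryGroupOfForm (galAdicCompletionMap (L := L) (IsCMField.complexConj L) hw) (placeForm H' w.1))) :
          GL (Fin 3) (w.1.adicCompletion L)) ht i
  -- depth zero at the constant coefficient: `|uD − 1| < 1`, hence `|D − 1| < 1` and `|1 − t + D| < 1` (★ R1's binder `hχ1`; no `|2| = 1`)
  have hiso := ValuativeRel.isEquiv (ValuativeRel.valuation (w.1.adicCompletion L)) (Valued.v : Valuation (w.1.adicCompletion L) (WithZero (Multiplicative ℤ)))
  have hc0 : ((((δ.val : GL (Fin 3) (LocalRing L v)) : Matrix (Fin 3) (Fin 3) (LocalRing L v)).map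
      (Pi.evalRingHom (fun w' : PlacesOver L v => w'.1.adicCompletion L) w)).charpoly - (Polynomial.X - 1) ^ 3).coeff 0 = -(u * D - 1) := by
    rw [coeff_sub, hχ, coeff_zero_eq_eval_zero, coeff_zero_eq_eval_zero]
    simp only [eval_mul, eval_sub, eval_add, eval_pow, eval_X, eval_C, eval_one]
    ring
  have huD : Valued.v (u * D - 1) < 1 := by
    have h := (hiso.lt_one_iff_lt_one).1 (ht 0)
    rw [hc0, Valuation.map_neg] at h
    exact h
  have hDle : Valued.v D ≤ 1 := (Valuation.mem_integer_iff _ _).1 hDO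
  have hD1 : Valued.v (D - 1) < 1 := by
    rw [show D - 1 = (u * D - 1) - D * (u - 1) by ring]
    refine lt_of_le_of_lt (Valuation.map_sub _ _ _) (max_lt huD ?_)
    rw [Valuation.map_mul]
    calc Valued.v D * Valued.v (u - 1) ≤ 1 * Valued.v (u - 1) := mul_le_mul_left hDle _
      _ < 1 := by rw [one_mul]; exact hu1
  have hχ1 : Valued.v (1 - t + D) < 1 := by
    rw [show 1 - t + D = (D - 1) - (t - 2) by ring]
    exact lt_of_le_of_lt (Valuation.map_sub _ _ _) (max_lt hD1 ht2)
  have hJh : ((((hH'w.unit : GL (Fin 3) (w.1.adicCompletion L)) : Matrix (Fin 3) (Fin 3) (w.1.adicCompletion L))).map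
      (galAdicCompletionMap (L := L) (IsCMField.complexConj L) hw))ᵀ = (hH'w.unit : GL (Fin 3) (w.1.adicCompletion L)) :=
    placeForm_hermitian_of_smul_eq (IsCMField.complexConj L) w H' hH' hw
  have hval := ncard_selfDual_cyclic_typeTwo_eq_ite_wildOdd L w hw hv he hH'w.unit hH'i hJh
    (((δ.val : GL (Fin 3) (LocalRing L v)) : Matrix (Fin 3) (Fin 3) (LocalRing L v)).map (Pi.evalRingHom (fun w' : PlacesOver L v => w'.1.adicCompletion L) w))
    hτU hint hχ hσu hσD hσt hu1 ht2 hχ1 hn' hdisc hNn hK hx₀ hx₀0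
  rw [hval, IsUnit.unit_spec, Finset.sum_comm]
  -- Step 3: the κ-reading
  have hiff : Even (WithZero.log (Valued.v (∑ i : Fin 3, ∑ k : Fin 3, galAdicCompletionMap (L := L) (IsCMField.complexConj L) hw (x₀ i) *
      placeForm H' w.1 i k * x₀ k)) + (n : ℤ)) ↔ (finKappaAt L v H' γH δ = 1 ↔ Even n) := by
    rw [Int.even_add, Int.even_coe_nat, hκ]
  by_cases hE : Even (WithZero.log (Valued.v (∑ i : Fin 3, ∑ k : Fin 3, galAdicCompletionMap (L := L) (IsCMField.complexConj L) hw (x₀ i) *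
      placeForm H' w.1 i k * x₀ k)) + (n : ℤ))
  · rw [if_pos hE, if_pos (hiff.1 hE)]
  · rw [if_neg hE, if_neg (fun h => hE (hiff.2 h))]
    simp

set_option synthInstance.maxHeartbeats 200000 in
set_option maxHeartbeats 400000 in
open scoped Classical in
/-- **THE FREE ROW OF THE TYPE-(2) SOCKET** (`hK₂` of ★ `finsum_finExplicitDelta_mul_classOrbitalIntegral_eq_of_irreducible_of_strata` with `np := n(δ₊)`, `nm := n(δ₋)`):
for deep matches `δ₊`, `δ₋` of a `G`-regular type-(2) `γ_H` (`χ_g` irreducible over `L_w`, eigen-discriminant of ODD order `2N + 1`) with `κ_v(γ_H, δ_±) = ±1`, at an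
inert-unramified `v` of ANY residue characteristic (`|2|_v = exp(−e)`), observable exponents `n`, `N` with `1 ≤ N − e + n`:
`n₂(δ₊) − n₂(δ₋) = (−1)^n · (q+1) · q^{N−e+n−1}` — the regular-nilpotent stratum is the set of self-dual `δ_w`-cyclic lattices, a torsor count `[C : R^×]` on exactly one
of the two classes (the one with `κ = (−1)^n`), and `[C : R^×] = (q+1)q^{N−e+n−1}` for the order `𝒪_w[δ_w] ⊂ L_w × K₁` (level `N − e`, ★ p852835).  Dyadic-safe twin of ★
`ncard_rankStrata_two_sub_eq_neg_one_pow_mul`.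
[cite: Rogawski1990, §4.9 Lemma 4.9.3 p. 56, Prop. 4.9.1 (b) p. 55] [cite: Flicker1998UnitaryFL, Props. 16–17 pp. 95–97] [cite: Kottwitz1986, §3] -/
theorem ncard_rankStrata_two_sub_eq_neg_one_pow_mul_wildOdd
    (hH' : (H'.map (IsCMField.complexConj L))ᵀ = H') (w : PlacesOver L v)
    (hw : IsCMField.complexConj L • w.1 = w.1) (hv : Algebra.IsUnramifiedIn (𝓞 L) v.asIdeal)
    (hH'w : IsUnit (placeForm H' w.1)) (hH'i : hH'w.unit ∈ glInt 3 (w.1.adicCompletion L))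
    {e : ℕ} (he : Valued.v (2 : v.adicCompletion ↥(maximalRealSubfield L)) = WithZero.exp (-(e : ℤ)))
    {γH : (cmDatum L 2 (Matrix.of fun i j : Fin 2 => if i.val + j.val + 1 = 2 then (1 : L) else 0)).Local v ×
      (cmDatum L 1 (Matrix.of fun i j : Fin 1 => if i.val + j.val + 1 = 1 then (1 : L) else 0)).Local v}
    (hreg : IsLocalGRegular L v γH)
    (hirr : ¬ ∃ x : w.1.adicCompletion L, (((γH.1.val : GL (Fin 2) (LocalRing L v)).val.map
        (Pi.evalRingHom (fun w' : PlacesOver L v => w'.1.adicCompletion L) w)).charpoly).IsRoot x)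
    (n N : ℕ)
    (hn : Valued.v (((finCharpolyTwo L v γH).eval (finGammaTwo L v γH)) w) = WithZero.exp (-(n : ℤ)))
    (hN : Valued.v (((γH.1.val : GL (Fin 2) (LocalRing L v)).val.map
        (Pi.evalRingHom (fun w' : PlacesOver L v => w'.1.adicCompletion L) w)).trace ^ 2 -
      4 * ((γH.1.val : GL (Fin 2) (LocalRing L v)).val.map
        (Pi.evalRingHom (fun w' : PlacesOver L v => w'.1.adicCompletion L) w)).det) = WithZero.exp (-((2 * N + 1 : ℕ) : ℤ)))
    (hNn : 1 ≤ N - e + n)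
    (δp : (cmDatum L 3 H').Local v) (hp : IsLocalNormPair L H' v γH δp) (hκp : finKappaAt L v H' γH δp = 1)
    (htp : ∀ m : ℕ, ValuativeRel.valuation (w.1.adicCompletion L)
      (((((δp.val : GL (Fin 3) (LocalRing L v)).val.map (Pi.evalRingHom (fun w' : UnitaryGroup.PlacesOver L v => w'.1.adicCompletion L) w))).charpoly -
        (Polynomial.X - 1) ^ 3).coeff m) < 1)
    (δm : (cmDatum L 3 H').Local v) (hm : IsLocalNormPair L H' v γH δm) (hκm : finKappaAt L v H' γH δm = -1)
    (htm : ∀ m : ℕ, ValuativeRel.valuation (w.1.adicCompletion L)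
      (((((δm.val : GL (Fin 3) (LocalRing L v)).val.map (Pi.evalRingHom (fun w' : UnitaryGroup.PlacesOver L v => w'.1.adicCompletion L) w))).charpoly -
        (Polynomial.X - 1) ^ 3).coeff m) < 1) :
    (({q : (cmDatum L 3 H').Local v ⧸ cmLocalIntegralLevel L 3 H' v |
            q ∈ MulAction.fixedBy ((cmDatum L 3 H').Local v ⧸ cmLocalIntegralLevel L 3 H' v) δp ∧
              (redMat ((((q.out⁻¹ * δp * q.out : (cmDatum L 3 H').Local v)).val : GL (Fin 3) (LocalRing L v)).val.map
                (Pi.evalRingHom (fun w' : UnitaryGroup.PlacesOver L v => w'.1.adicCompletion L) w)) - 1).rank = 2}.ncard : ℕ) : ℚ) -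
      (({q : (cmDatum L 3 H').Local v ⧸ cmLocalIntegralLevel L 3 H' v |
            q ∈ MulAction.fixedBy ((cmDatum L 3 H').Local v ⧸ cmLocalIntegralLevel L 3 H' v) δm ∧
              (redMat ((((q.out⁻¹ * δm * q.out : (cmDatum L 3 H').Local v)).val : GL (Fin 3) (LocalRing L v)).val.map
                (Pi.evalRingHom (fun w' : UnitaryGroup.PlacesOver L v => w'.1.adicCompletion L) w)) - 1).rank = 2}.ncard : ℕ) : ℚ) =
      (-1 : ℚ) ^ n * ((Ideal.absNorm v.asIdeal : ℚ) + 1) * (Ideal.absNorm v.asIdeal : ℚ) ^ (N - e + n - 1) := by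
  rw [ncard_rankStratum_two_typeTwo_eq_ite_wildOdd L H' hH' w hw hv hH'w hH'i he hreg hirr n N hn hN hNn hp htp,
    ncard_rankStratum_two_typeTwo_eq_ite_wildOdd L H' hH' w hw hv hH'w hH'i he hreg hirr n N hn hN hNn hm htm, hκp, hκm]
  rcases Nat.even_or_odd n with hev | hodd
  · have h1 : ((1 : ℤ) = 1 ↔ Even n) := ⟨fun _ => hev, fun _ => rfl⟩
    have h2' : ¬ ((-1 : ℤ) = 1 ↔ Even n) := fun h => absurd (h.2 hev) (by decide)
    rw [if_pos h1, if_neg h2', hev.neg_one_pow]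
    push_cast
    ring
  · have h1 : ¬ ((1 : ℤ) = 1 ↔ Even n) := fun h => (Nat.not_even_iff_odd.2 hodd) (h.1 rfl)
    have h2' : ((-1 : ℤ) = 1 ↔ Even n) := ⟨fun h => absurd h (by decide), fun h => absurd h (Nat.not_even_iff_odd.2 hodd)⟩
    rw [if_neg h1, if_pos h2', hodd.neg_one_pow]
    push_cast
    ring

end CM

end Literature.NumberTheory.Rogawski1990

end
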